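import Summits.CriticalPhenomena.CardyFormulaZ2.Theses.CardyBoundaryCoulombGas
import Literature.Probability.LatticeModels.CollarLegModel

/-!
# Line `connectivity-is-boundary-spin-covariance` — crux `CardyBoundaryCoulombGas.BoundaryDefectGaussianR` (stmt-CriticalPhenomena-14132)

Skeleton of the line (crux-plan, `planner-cruxplan-stmt-CriticalPhenomena-14132-connectivity-is-boun-0`, 2026-08-16)
for the triaged crux idea `connectivity-is-boundary-spin-covariance` (crux-ideate r1, ideator 1; triage r1: 3 × pass,
merge with `edge-spin-dictionary` = same lever; `Cruxes/BoundaryDefectGaussianR/Ideas/…`, `TRIAGE-r1-{1,2,3}.md`).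

THE CRUX (typed 2026-08-16T02:27Z; general rainbow-leg family law, see `MemberLaw`). For leg data `(k, L, j)`
(`k` insertion points = the marks of a rectilinear `MarkedDomain k`, all off corners; leg numbers `L`; sink `j` with
`L j = Σ_{i≠j} L i`), a conformal bijection `w : Ω → ℍ` analytic at the marks and positively oriented there, any mesh
sequence `δ_n → 0⁺`, `V n = Ω̄ ∩ δ_nℤ²`, admissible lattice insertion points `p n i → pt i`:
`δ_n^{-Σ_i h(e_i)} · ‖Zins (V n) ι_n‖ / ‖Z (V n)‖ → C · ∏_{i<i'} ‖w(pt i) − w(pt i')‖^{e_ie_{i'}/3} · ∏_i ‖w′(pt i)‖^{h(e_i)}`,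
`e_i = L_i` (`i ≠ j`), `e_j = 1 − L_j`, `h(e) = e(e−1)/6`, with ONE constant `C = C(k, L, j) > 0`.

THE LINE, in one sentence: CONNECTIVITY IS COVARIANCE. For the FLAT closed collar (no insertion) call
`s_v := h_v − 0 ∈ {±1}` the boundary spin of a boundary vertex `v` (the orientation of the one BKW loop squeezed
between `v` and the collar). Then, exactly and at every mesh (simply connected lattice domains),
`⟨s_v⟩ = i√3`, `⟨s_x s_y⟩ = 4·P_{1/2}[x ↔ y] − 3`, `Z = 2^{|E|}`, i.e. `P[x ↔ y] = ¼·Cov(s_x, s_y)` — the `(2;2)` member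
of the crux (`k = 2`, `L = (2,2)`: one 2-leg source, the 2-leg sink; `e = (2,−1)`, `Σh = 2/3`) is an ELECTRIC
two-point CUMULANT of ONE fixed model, the positive flat-Dirichlet `(1,1,√3)` six-vertex measure `P₊` under the
product tilt `e^{iμB′}`, `μ = π/12` (card; verified by four independent exact enumerations, triage r1-1/2/3).

1. LEG DICTIONARY (`stub_legDictionary22`, provable now, L): `‖Zins (V n) ι‖ = P[x ↔ y in V n]·‖Z (V n)‖` for every
   admissible `(2;2)` datum, eventually along the exhaustion (SPEC §D4 of the crux: the two legs born at the `±2`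
   jump edges are the hull strands of the source's cluster and must end at the sink). Serves every line.
2. SPIN DICTIONARY (`stub_spinDictionary`, provable now, L): the three flat-collar identities above, eventually along
   the exhaustion, at all non-corner boundary vertices (exactly one lattice neighbour outside `V n`). THE LEVER.
   Stated "eventually" because it is FALSE with lattice holes (triage r1-1: ring `3×3∖centre`, `Z = 257 ≠ 256`) and
   `Ω̄ ∩ δℤ²` of a rectilinear polygon is hole-free only once `δ` is below the feature size.
3. BOUNDARY-SPIN CUMULANT LAW `C⁺` (`stub_spinCumulantLaw`, OPEN, XL — HARDEST; the card's Transfer): in the `(2;2)`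
   geometry of the crux, `δ_n^{-2/3}(⟨s_xs_y⟩ − ⟨s_x⟩⟨s_y⟩) → C|w(x) − w(y)|^{-2/3}|w′(x)|^{1/3}|w′(y)|^{1/3}`.
   EQUIVALENT to the `(2;2)` member mesh by mesh (by 1–2), so nothing is lost and nothing is hidden: the whole
   analytic depth of the member (the half-plane one-arm exponent `1/3` of bond-ℤ², sharp constants, conformal
   covariance in polygons) sits here. What the transfer buys is the CATEGORY: a cumulant-generating-function
   derivative `−∂_α∂_β log E₊[e^{i(μB′ + αs_x + βs_y)}]` of one FKG / RP / Markov Gibbs measure under the explicit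
   boundary polymer tilt `e^{iμB′} = (cos μ)^{|ext|}∏(1 + i tan μ · s)`, activity `tan μ = 2 − √3`; on strips the
   θ-family `E₊[e^{iθB′}]` is the open `Δ = −1/2` chain with diagonal boundary matrix of ratio `e^{2iθ}`
   (Sklyanin-integrable, `U_q(sl₂)`-invariant at `θ = μ`) whose θ-derivatives at `μ` are exact percolation data.
   First records inside the stub: the wall/strip version (rate `π/3` = `StripClusterRates`' one-cluster block,
   no `e^{−2πt}` amplitude), the `q = 2` unit test (Ising boundary spins, weight 1/2, a theorem by discrete
   fermions), existence of the limit with an unidentified kernel.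
4. THE FOREIGN RESIDUAL (`stub_otherMembers`, OPEN, XL⁺, NOT attacked by this line): the crux's law for every leg
   family other than `(2;2)` — including the route's other load-bearing member, the mark density `(1,1,1;3)`. The
   spin dictionary cannot reach it: the character expansion of the boundary visit transform is invertible only
   at two points (`Catalan(k) > 2^k` from `k = 4` on; the ELECTRIC reading of the mark density is refuted,
   stmt-CriticalPhenomena-6952, Farkas certificates on 10 domains). Levers on file: `sink-identity-calibration`,
   `twist-anomaly-factorisation`, `rainbow-monomials-in-excursion-kernels`, `corner-kac-tower-strip-end`.
   RECOMMENDED to the lead / tenure planner: split the crux item along the seam "(2;2) member | other members";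
   this file types both halves and proves the glue.

`BoundaryDefectGaussianR_of` composes the four stubs into the crux BY NAME (kernel-checked, axioms `propext`,
`Classical.choice`, `Quot.sound`; no `sorry` outside the four `stub_*`); `member22` is the kernel-checked REACH of the
line without the foreign stub: leg dictionary + spin dictionary + cumulant law ⟹ `MemberLaw 2 ![2,2] j` for either
sink index `j` — including the crux's own bookkeeping for this family (`Σh = 2/3`, pair exponent `−2/3`, weights
`1/3, 1/3`: `sum_weights22`, `pair22`, `weight22`, `rhs22`) and the cumulant algebra `S₂/Z − S₁S₁′/Z² = 4P`
(`cumulant_eq`: `(i√3)² = −3` cancels the `−3`).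

## Disproof used (`Cruxes/BoundaryDefectGaussianR/Disproof.lean`, cdisprove cycle 2 v4, 2026-08-16T02:22Z, 1479 lines rc 0)
* No `_false_without_<H>` theorem exists (the crux was informal through cycle 2; §3/§8′: "no line picked, no stub
  targets"). Nothing to honour by name; the typed obstructions below are.
* §2 `not_lawInAllMoebiusFrames_naiveSink` / `hw_eq_hw_iff` (the sink label `1 − L` is forced by covariance):
  HONOURED — for `(2;2)` the labels `(2, −1)` give `Σe = 1`; `sum_weights22`/`pair22`/`rhs22` check the crux's own
  exponent arithmetic for this family in Lean, for either sink index; STUB 3 carries exactly these exponents.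
* §4 `not_halfPlaneTwoPointLawUniform` (no uniformity up to the diagonal): HONOURED — STUB 3 and the crux are
  stated along sequences of insertion points converging to DISTINCT fixed marks (`MarkedDomain 2`), never uniformly
  in the pair.
* §5 H-noncorner / H-onto / H-finite / `∃ C ∀ …` order: HONOURED — STUB 3 copies the crux's hypotheses verbatim
  (non-corner marks, `Set.BijOn w Ω ℍ`, `w` differentiable on an open `U ∋ pt i`, `∃ C` first). The spin IDENTITIES
  (STUB 2) hold at corners too (triage), but are only claimed at non-corner boundary vertices.
* §9 `sharpTwoPoint_of_twoPointLaw` / §11 (the crux asserts SHARP asymptotics): ACKNOWLEDGED — STUB 3 is equally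
  sharp (it is equivalent to the member); the triage's self-normalised variant (divide by `ν₂(δ)²`) is recorded in
  the line card as the fallback reshaping if only exponents are wanted downstream.
* §7/§10 exact-TM numerics for `(2;2)` (amplitude `C = 0.752 ± 0.004`, `|w′|^{1/3}` corner-proximity law, strip ↔
  half-plane ↔ half-strip to 1e-3): consistent with STUB 3; the card's falsifier (2) (θ-derivative identities on
  strips) is the next cheap test and is recorded in the line card, not claimed here.
* Landed `Theorems/BoundaryDefectGaussianR/Negative/` (cdisprove g2, 2026-08-16T02:18–02:27Z; imported in the
  planner's scratch check of this file): `MarkDensityPartition` (exact partition of the crossing event by the mark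
  events, Fatou cap), `MarkDensityConstantCap` (`markDensity_constant_le`: every pointwise limit `C·shape` of the
  member-(i) density on `ℤ × ℕ` has `C ≤ cardyConst/3`; `not_markDensityLaw_of_gt`), `MarkDensityArcSubadditive`
  (`limitDensity_subadditive_in_arc`). All concern member (i) = the mark density: STUBS 1–3 are about `(2;2)` and
  are not instances; STUB 4 asserts member (i) only inside the crux's own `∃ C > 0` (no constant above the cap is
  claimed) and with the crux's shape, which passes the arc-subadditivity filter (Disproof §9b) — not an instance.
  `ledger negatives --problem CriticalPhenomena` (9 refuted statements, 2026-08-16): none concerns boundary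
  connectivities or the collar model; no stub is an instance of stmt-6947 (`κ = 2/3` pair coupling — here `1/3`)
  or of stmt-6952 (electric reading of the MARK DENSITY — explicitly excluded, see STUB 4).
-/


noncomputable section

open Filter Topology

namespace Summit.CriticalPhenomena.CardyFormulaZ2.Cruxes.BoundaryDefectGaussianR.ConnectivityIsBoundarySpinCovariance

/-! ## The crux, member by member -/

/-- `MemberLaw k L j`: the crux's law for ONE leg family — `k` insertion points (the marks of a
`MarkedDomain k`), leg numbers `L`, sink index `j` (so `L j = Σ_{i ≠ j} L i`). This is LITERALLY the body of
`Summit.CriticalPhenomena.CardyFormulaZ2.Theses.CardyBoundaryCoulombGas.BoundaryDefectGaussianR`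
after its `(k, L, j)` binders (see `boundaryDefectGaussianR_iff`, `Iff.rfl`). Labels: `e_i = L_i` (`i ≠ j`),
`e_j = 1 - L_j`; weights `h(e) = e(e-1)/6`; lattice side `δ_n^{-Σh} ‖Zins (V n) ι_n‖ / ‖Z (V n)‖` along any mesh
sequence `δ_n → 0⁺`, `V n = Ω̄ ∩ δ_nℤ²`, admissible insertion points `p n i → D.pt i`. -/
def MemberLaw (k : ℕ) (L : Fin k → ℕ) (j : Fin k) : Prop :=
  ∃ C : ℝ, 0 < C ∧ ∀ (D : Literature.Probability.RandomPlanarGeometry.MarkedDomain k), (∃ S : Finset (ℂ × ℂ), (∀ p ∈ S, p.1.re = p.2.re ∨ p.1.im = p.2.im) ∧ frontier D.carrier ⊆ ⋃ p ∈ S, segment ℝ p.1 p.2) → (∀ i, ∃ r : ℝ, 0 < r ∧ ((∀ z ∈ frontier D.carrier, dist z (D.pt i) < r → z.im = (D.pt i).im) ∨ (∀ z ∈ frontier D.carrier, dist z (D.pt i) < r → z.re = (D.pt i).re))) → ∀ (w : ℂ → ℂ) (U : Set ℂ), IsOpen U → D.carrier ⊆ U → (∀ i, D.pt i ∈ U)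 → DifferentiableOn ℂ w U → Set.BijOn w D.carrier {z : ℂ | 0 < z.im} → (∀ i, ∃ ε : ℝ, 0 < ε ∧ StrictMonoOn (fun t : ℝ ↦ (w (D.boundary t)).re) (Set.Ioo (D.mark i - ε) (D.mark i + ε))) → ∀ (δ : ℕ → ℝ), (∀ n, 0 < δ n) → Filter.Tendsto δ Filter.atTop (nhds 0) → ∀ (V : ℕ → Finset (ℤ × ℤ)), (∀ n, ∀ v : ℤ × ℤ, v ∈ V n ↔ ((v.1 : ℂ) * δ n + (v.2 : ℂ) * δ n * Complex.I) ∈ closure D.carrier) → ∀ (p : ℕ → Fin k → ℤ × ℤ), (∀ n, Function.Injective (p n)) → (∀ i, Filter.Tendsto (fun n ↦ ((p n i).1 : ℂ) * δ n + ((p n i).2 : ℂ) * δ n * Complex.I) Filter.atTop (nhds (D.pt i))) → (∀ n, Literature.Probability.LatticeModels.CollarLegModel.LegInsertionData.IsAdmissible ⟨(Finset.univ.erase j).image (p n), fun v ↦ ∑ i ∈ (Finset.univ.erase j).filter (fun i ↦ p n i = v), L i, p n j⟩ (V n)) → Filter.Tendsto (fun n ↦ (δ n) ^ (-(∑ i :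 Fin k, (if i = j then (1 - (L j : ℝ)) else (L i : ℝ)) * ((if i = j then (1 - (L j : ℝ)) else (L i : ℝ)) - 1) / 6)) * ‖Literature.Probability.LatticeModels.CollarLegModel.Zins (V n) ⟨(Finset.univ.erase j).image (p n), fun v ↦ ∑ i ∈ (Finset.univ.erase j).filter (fun i ↦ p n i = v), L i, p n j⟩‖ / ‖(Literature.Probability.LatticeModels.CollarLegModel.ofDomain (V n)).Z‖) Filter.atTop (nhds (C * (∏ i : Fin k, ∏ i' ∈ Finset.univ.filter (fun i' : Fin k ↦ i < i'), ‖w (D.pt i) - w (D.pt i')‖ ^ ((if i = j then (1 - (L j : ℝ)) else (L i : ℝ)) * (if i' = j then (1 - (L j : ℝ)) else (L i' : ℝ)) / 3)) * ∏ i : Fin k, ‖deriv w (D.pt i)‖ ^ ((if i = j then (1 - (L j : ℝ)) else (L i : ℝ)) * ((if i = j then (1 - (L j : ℝ)) else (L i : ℝ)) - 1) / 6)))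

/-- The crux is `MemberLaw` at every leg family, definitionally. -/
theorem boundaryDefectGaussianR_iff :
    Summit.CriticalPhenomena.CardyFormulaZ2.Theses.CardyBoundaryCoulombGas.BoundaryDefectGaussianR ↔
      ∀ (k : ℕ) (L : Fin k → ℕ) (j : Fin k), L j = ∑ i ∈ Finset.univ.erase j, L i → MemberLaw k L j :=
  Iff.rfl

/-! ## The statements of the line (named `Prop`s over tree declarations; the registered `stub_*` theorems below
restate them verbatim and fully qualified, so that a Theorems-side `propose --supports stmt-CriticalPhenomena-14132`
proof can restate them textually; `Registered.stub_*` are the name-keyed aliases taken as hypotheses of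
`BoundaryDefectGaussianR_of`) -/

section Statements

open Literature.Probability.RandomPlanarGeometry Literature.Probability.LatticeModels
  Literature.Probability.Percolation Literature.Probability.LatticeModels.CollarLegModel

/-- STUB 1 statement — the LEG DICTIONARY for `(2;2)`: along any closed-lattice exhaustion `V n = Ω̄ ∩ δ_nℤ²` of a
rectilinear Jordan domain, EVENTUALLY (once `V n` is simply connected at lattice level) every admissible `(2;2)`
insertion datum at boundary vertices `q 0, q 1` has `‖Zins (V n) ι‖ = P_{1/2}[q 0 ↔ q 1 in V n] · ‖Z (V n)‖`
(SPEC §D4 of the crux: the jump-by-2 collar emits the two hull strands of the cluster pinned at the source, which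
must end at the sink — an identity of the definition, enumeration-verified in 106 placements). -/
def LegDictionary22 : Prop :=
  ∀ (D : JordanDomain), (∃ S : Finset (ℂ × ℂ), (∀ p ∈ S, p.1.re = p.2.re ∨ p.1.im = p.2.im) ∧
      frontier D.carrier ⊆ ⋃ p ∈ S, segment ℝ p.1 p.2) →
    ∀ (δ : ℕ → ℝ), (∀ n, 0 < δ n) → Tendsto δ atTop (𝓝 0) →
    ∀ (V : ℕ → Finset (ℤ × ℤ)),
      (∀ n, ∀ v : ℤ × ℤ, v ∈ V n ↔ ((v.1 : ℂ) * δ n + (v.2 : ℂ) * δ n * Complex.I) ∈ closure D.carrier) →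
      ∀ᶠ n in atTop, ∀ (q : Fin 2 → ℤ × ℤ) (j : Fin 2),
        LegInsertionData.IsAdmissible ⟨(Finset.univ.erase j).image q,
          fun v ↦ ∑ i ∈ (Finset.univ.erase j).filter (fun i ↦ q i = v), (![2, 2] : Fin 2 → ℕ) i, q j⟩ (V n) →
        ‖Zins (V n) ⟨(Finset.univ.erase j).image q,
            fun v ↦ ∑ i ∈ (Finset.univ.erase j).filter (fun i ↦ q i = v), (![2, 2] : Fin 2 → ℕ) i, q j⟩‖ =
          (bondPercolation (zdGraph 2) half).real
              (openConnIn {s : Site 2 | (s 0, s 1) ∈ V n} ![(q 0).1, (q 0).2] ![(q 1).1, (q 1).2]) *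
            ‖(ofDomain (V n)).Z‖

/-- STUB 2 statement — the SPIN DICTIONARY of the FLAT collar (the lever): along the same exhaustions,
EVENTUALLY `Z (V n) = 2^{|E|}`, and for all non-corner boundary vertices `x, y` of `V n` (exactly one lattice
neighbour outside): `Σ_h w(h) s_x = i√3 · Z` and `Σ_h w(h) s_x s_y = (4·P_{1/2}[x ↔ y in V n] − 3) · Z`, where
`s_v = h_v − 0 ∈ {±1}` is the boundary spin (the height of `v` above the collar = the orientation of the one BKW
loop squeezed between `v` and the collar). -/
def SpinDictionary : Prop :=
  ∀ (D : JordanDomain), (∃ S : Finset (ℂ × ℂ), (∀ p ∈ S, p.1.re = p.2.re ∨ p.1.im = p.2.im) ∧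
      frontier D.carrier ⊆ ⋃ p ∈ S, segment ℝ p.1 p.2) →
    ∀ (δ : ℕ → ℝ), (∀ n, 0 < δ n) → Tendsto δ atTop (𝓝 0) →
    ∀ (V : ℕ → Finset (ℤ × ℤ)),
      (∀ n, ∀ v : ℤ × ℤ, v ∈ V n ↔ ((v.1 : ℂ) * δ n + (v.2 : ℂ) * δ n * Complex.I) ∈ closure D.carrier) →
      ∀ᶠ n in atTop,
        (ofDomain (V n)).Z = (2 : ℂ) ^ (ofDomain (V n)).E.card ∧
        ∀ x : ℤ × ℤ, x ∈ V n → ((neighbours x).filter (fun u ↦ u ∉ V n)).card = 1 →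
          (∑ h ∈ (ofDomain (V n)).configs, (ofDomain (V n)).weight h * (((ofDomain (V n)).hv h x : ℤ) : ℂ)) =
              Complex.I * ((Real.sqrt 3 : ℝ) : ℂ) * (ofDomain (V n)).Z ∧
          ∀ y : ℤ × ℤ, y ∈ V n → ((neighbours y).filter (fun u ↦ u ∉ V n)).card = 1 →
            (∑ h ∈ (ofDomain (V n)).configs, (ofDomain (V n)).weight h *
                (((ofDomain (V n)).hv h x : ℤ) : ℂ) * (((ofDomain (V n)).hv h y : ℤ) : ℂ)) =
              (4 * (((bondPercolation (zdGraph 2) half).real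
                  (openConnIn {s : Site 2 | (s 0, s 1) ∈ V n} ![x.1, x.2] ![y.1, y.2]) : ℝ) : ℂ) - 3) *
                (ofDomain (V n)).Z

/-- STUB 3 statement — the BOUNDARY-SPIN CUMULANT LAW `C⁺` (the line's transfer target; HARDEST): for the
`(2;2)` geometry of the crux (a rectilinear `MarkedDomain 2` with non-corner marks `x = pt 0`, `y = pt 1`, a
conformal `w : Ω → ℍ` analytic at the marks, mesh sequence, closed-lattice exhaustion, boundary lattice points
`p n i → pt i`), the flat-collar spin CUMULANT obeys the pure-product law
`δ_n^{-2/3} · (⟨s_x s_y⟩ − ⟨s_x⟩⟨s_y⟩) → C · |w(x) − w(y)|^{-2/3} · |w′(x)|^{1/3} |w′(y)|^{1/3}`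
(expectations `⟨·⟩ = Z⁻¹ Σ_h w(h)(·)`, complex a priori; the limit is real). -/
def SpinCumulantLaw : Prop :=
  ∃ C : ℝ, 0 < C ∧ ∀ (D : MarkedDomain 2), (∃ S : Finset (ℂ × ℂ), (∀ p ∈ S, p.1.re = p.2.re ∨ p.1.im = p.2.im) ∧
      frontier D.carrier ⊆ ⋃ p ∈ S, segment ℝ p.1 p.2) →
    (∀ i, ∃ r : ℝ, 0 < r ∧ ((∀ z ∈ frontier D.carrier, dist z (D.pt i) < r → z.im = (D.pt i).im) ∨
      (∀ z ∈ frontier D.carrier, dist z (D.pt i) < r → z.re = (D.pt i).re))) →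
    ∀ (w : ℂ → ℂ) (U : Set ℂ), IsOpen U → D.carrier ⊆ U → (∀ i, D.pt i ∈ U) → DifferentiableOn ℂ w U →
      Set.BijOn w D.carrier {z : ℂ | 0 < z.im} →
      (∀ i, ∃ ε : ℝ, 0 < ε ∧ StrictMonoOn (fun t : ℝ ↦ (w (D.boundary t)).re) (Set.Ioo (D.mark i - ε) (D.mark i + ε))) →
    ∀ (δ : ℕ → ℝ), (∀ n, 0 < δ n) → Tendsto δ atTop (𝓝 0) →
    ∀ (V : ℕ → Finset (ℤ × ℤ)),
      (∀ n, ∀ v : ℤ × ℤ, v ∈ V n ↔ ((v.1 : ℂ) * δ n + (v.2 : ℂ) * δ n * Complex.I) ∈ closure D.carrier) →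
    ∀ (p : ℕ → Fin 2 → ℤ × ℤ), (∀ n, Function.Injective (p n)) →
      (∀ i, Tendsto (fun n ↦ ((p n i).1 : ℂ) * δ n + ((p n i).2 : ℂ) * δ n * Complex.I) atTop (𝓝 (D.pt i))) →
      (∀ n i, p n i ∈ V n ∧ ((neighbours (p n i)).filter (fun u ↦ u ∉ V n)).card = 1) →
      Tendsto (fun n : ℕ ↦ (((δ n) ^ (-(2 / 3 : ℝ)) : ℝ) : ℂ) *
          ((∑ h ∈ (ofDomain (V n)).configs, (ofDomain (V n)).weight h *
              (((ofDomain (V n)).hv h (p n 0) : ℤ) : ℂ) * (((ofDomain (V n)).hv h (p n 1) : ℤ) : ℂ)) /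
              (ofDomain (V n)).Z -
            (∑ h ∈ (ofDomain (V n)).configs, (ofDomain (V n)).weight h * (((ofDomain (V n)).hv h (p n 0) : ℤ) : ℂ)) *
              (∑ h ∈ (ofDomain (V n)).configs, (ofDomain (V n)).weight h * (((ofDomain (V n)).hv h (p n 1) : ℤ) : ℂ)) /
              (ofDomain (V n)).Z ^ 2))
        atTop (𝓝 ((C * ‖w (D.pt 0) - w (D.pt 1)‖ ^ (-(2 / 3 : ℝ)) *
          (‖deriv w (D.pt 0)‖ ^ (1 / 3 : ℝ) * ‖deriv w (D.pt 1)‖ ^ (1 / 3 : ℝ)) : ℝ) : ℂ))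

end Statements

/-! ## The registered stubs (`sorry` lives only here; signatures verbatim, `let`-free, fully qualified) -/

/-- **STUB 1 · `stub_legDictionary22`** (L, PROVABLE NOW — finite combinatorics of the landed definition) — the
LEG DICTIONARY for the `(2;2)` member: eventually along a closed-lattice exhaustion of a rectilinear Jordan domain,
`‖Zins (V n) ι‖ = P_{1/2}[q 0 ↔ q 1 in V n] · ‖Z (V n)‖` for every admissible `(2;2)` datum `ι` (one 2-leg source,
the 2-leg sink). The work: (a) BKW loop representation of `CollarLegModel.ofDomain`/`ι.model` on a simply
connected `V` (height configurations ↔ orientations of the fully packed loops of a bond configuration `ω ⊆ E`,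
weights `∏ √3`-or-`1` = sum over the two pairings, collar phases = `e^{±iμ}` per turn; for the jump collar the
two legs born at the `±2` jump edges are the two hull strands of the cluster of the source, forced to end at the
sink ⇔ `q 0 ↔ q 1`; closed loops weigh `2cos(π/3) = 1`, the open strands a configuration-independent phase);
(b) lattice hygiene: for a bounded rectilinear polygon `V n = Ω̄ ∩ δ_nℤ²` has no lattice holes / width-one
spikes for `n` large (features ≫ `δ_n`). Why it might need reshaping: only if `IsAdmissible` admits a placement
whose two-dart footprint the identity misses (the definition's validation found none off spikes). Leans on:
`CollarLegModel.Zins/.ofDomain/.Z/.weight/.configs`, `LegInsertionData.IsAdmissible/.collar/.walk`,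
`BKWOrientationExpansion` (the orientation-sum bookkeeping, bulk), `bondPercolation_indep`, `openConnIn`.
[BaxterKellandWu1976; arXiv:2603.06268 §3.2; SPEC-CollarLegInsertions.md on the item] -/
theorem stub_legDictionary22 : ∀ (D : Literature.Probability.RandomPlanarGeometry.JordanDomain), (∃ S : Finset (ℂ × ℂ), (∀ p ∈ S, p.1.re = p.2.re ∨ p.1.im = p.2.im) ∧ frontier D.carrier ⊆ ⋃ p ∈ S, segment ℝ p.1 p.2) → ∀ (δ : ℕ → ℝ), (∀ n, 0 < δ n) → Filter.Tendsto δ Filter.atTop (nhds 0) → ∀ (V : ℕ → Finset (ℤ × ℤ)), (∀ n, ∀ v : ℤ × ℤ, v ∈ V n ↔ ((v.1 : ℂ) * δ n + (v.2 : ℂ) * δ n * Complex.I) ∈ closure D.carrier) → Filter.Eventually (fun n : ℕ ↦ ∀ (q : Fin 2 → ℤ × ℤ) (j : Fin 2), Literature.Probability.LatticeModels.CollarLegModel.LegInsertionData.IsAdmissible ⟨(Finset.univ.erase j).image q, fun v ↦ ∑ i ∈ (Finset.univ.erase j).filter (fun i ↦ q i = v), (![2, 2] : Fin 2 → ℕ)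 i, q j⟩ (V n) → ‖Literature.Probability.LatticeModels.CollarLegModel.Zins (V n) ⟨(Finset.univ.erase j).image q, fun v ↦ ∑ i ∈ (Finset.univ.erase j).filter (fun i ↦ q i = v), (![2, 2] : Fin 2 → ℕ) i, q j⟩‖ = (Literature.Probability.Percolation.bondPercolation (Literature.Probability.LatticeModels.zdGraph 2) Literature.Probability.Percolation.half).real (Literature.Probability.Percolation.openConnIn {s : Literature.Probability.LatticeModels.Site 2 | (s 0, s 1) ∈ V n} ![(q 0).1, (q 0).2] ![(q 1).1, (q 1).2]) * ‖(Literature.Probability.LatticeModels.CollarLegModel.ofDomain (V n)).Z‖) Filter.atTop := by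
  sorry

/-- **STUB 2 · `stub_spinDictionary`** (L, PROVABLE NOW — the lever's identities) — the SPIN DICTIONARY of the
flat collar: eventually along a closed-lattice exhaustion of a rectilinear Jordan domain, `Z = 2^{|E|}`,
`Σ_h w(h) s_x = i√3·Z` at every non-corner boundary vertex and `Σ_h w(h) s_x s_y = (4·P_{1/2}[x ↔ y in V n] − 3)·Z`
at every pair of them. WHY TRUE: in the BKW loop representation of the flat collar every boundary vertex `v`
sits inside exactly one loop `ℓ_v` adjacent to the collar, `s_v` is its orientation, the orientation sums are
independent per loop with `E e^{±i(π/3)}`-weights: one marked loop gives `(e^{iπ/3} − e^{−iπ/3})/1 = i√3`; two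
points on the SAME loop (⇔ same cluster hull ⇔ `x ↔ y`, simply connected `V`) give `1`, on different loops
`(i√3)² = −3`; hence `⟨s_x s_y⟩ = P − 3(1 − P) = 4P − 3`. Verified by four independent exact enumerations (ideator,
triage r1-1/2/3: 222 pairs on 7 domains incl. corners, ≤ 4e-15). FALSE with lattice holes (triage r1-1:
ring 3×3∖centre, `Z = 257`), whence the "eventually" (hygiene (b) of STUB 1). Leans on: `CollarLegModel.ofDomain`,
`.configs/.weight/.hv/.Z/.E`, `CollarLegModelSanity.Z_1x1/Z_2x1` (unit tests), `BKWOrientationExpansion`,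
`CosMuNestingTransform` (bulk analogue). [BaxterKellandWu1976; arXiv:2603.06268 §3.2, Cor. 10] -/
theorem stub_spinDictionary : ∀ (D : Literature.Probability.RandomPlanarGeometry.JordanDomain), (∃ S : Finset (ℂ × ℂ), (∀ p ∈ S, p.1.re = p.2.re ∨ p.1.im = p.2.im) ∧ frontier D.carrier ⊆ ⋃ p ∈ S, segment ℝ p.1 p.2) → ∀ (δ : ℕ → ℝ), (∀ n, 0 < δ n) → Filter.Tendsto δ Filter.atTop (nhds 0) → ∀ (V : ℕ → Finset (ℤ × ℤ)), (∀ n, ∀ v : ℤ × ℤ, v ∈ V n ↔ ((v.1 : ℂ) * δ n + (v.2 : ℂ) * δ n * Complex.I) ∈ closure D.carrier) → Filter.Eventually (fun n : ℕ ↦ (Literature.Probability.LatticeModels.CollarLegModel.ofDomain (V n)).Z = (2 : ℂ) ^ (Literature.Probability.LatticeModels.CollarLegModel.ofDomain (V n)).E.card ∧ ∀ x : ℤ × ℤ, x ∈ V n → ((Literature.Probability.LatticeModels.CollarLegModel.neighbours x).filter (fun u ↦ u ∉ V n)).card = 1 → (∑ h ∈ (Literature.Probability.LatticeModels.CollarLegModel.ofDomain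 (V n)).configs, (Literature.Probability.LatticeModels.CollarLegModel.ofDomain (V n)).weight h * (((Literature.Probability.LatticeModels.CollarLegModel.ofDomain (V n)).hv h x : ℤ) : ℂ)) = Complex.I * ((Real.sqrt 3 : ℝ) : ℂ) * (Literature.Probability.LatticeModels.CollarLegModel.ofDomain (V n)).Z ∧ ∀ y : ℤ × ℤ, y ∈ V n → ((Literature.Probability.LatticeModels.CollarLegModel.neighbours y).filter (fun u ↦ u ∉ V n)).card = 1 → (∑ h ∈ (Literature.Probability.LatticeModels.CollarLegModel.ofDomain (V n)).configs, (Literature.Probability.LatticeModels.CollarLegModel.ofDomain (V n)).weight h * (((Literature.Probability.LatticeModels.CollarLegModel.ofDomain (V n)).hv h x : ℤ) : ℂ) * (((Literature.Probability.LatticeModels.CollarLegModel.ofDomain (V n)).hv h y : ℤ) : ℂ)) = (4 * (((Literature.Probability.Percolation.bondPercolation (Literature.Probability.LatticeModels.zdGraph 2) Literature.Probability.Percolation.half).real (Literature.Probability.Percolation.openConnIn {s : Literature.Probability.LatticeModels.Site 2 | (s 0, s 1) ∈ V n} ![x.1, x.2] ![y.1, y.2]) : ℝ) : ℂ) - 3)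 * (Literature.Probability.LatticeModels.CollarLegModel.ofDomain (V n)).Z) Filter.atTop := by
  sorry

/-- **STUB 3 · `stub_spinCumulantLaw`** (XL, OPEN — THE TRANSFER TARGET `C⁺`; HARDEST; the lead holds this one) —
for the `(2;2)` geometry of the crux, the flat-collar boundary-spin cumulant obeys
`δ_n^{-2/3}(⟨s_x s_y⟩ − ⟨s_x⟩⟨s_y⟩) → C·|w(x) − w(y)|^{-2/3}|w′(x)|^{1/3}|w′(y)|^{1/3}`. By STUBS 1–2 this is
EQUIVALENT, mesh by mesh, to the `(2;2)` member of the crux (`⟨s_xs_y⟩ − ⟨s_x⟩⟨s_y⟩ = 4P[x ↔ y]`), so nothing is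
lost; what is gained is the CATEGORY: a cumulant-generating-function derivative `−∂_α∂_β log E₊[e^{i(μB′+αs_x+βs_y)}]`
of ONE fixed positive Gibbs measure `P₊` (the flat-Dirichlet `(1,1,√3)` six-vertex measure on `V n`: FKG, CBC,
spatial Markov, reflection positivity across lattice lines) under the explicit product tilt
`e^{iμB′} = (cos μ)^{|ext|} ∏_e (1 + i tan μ · s_{v(e)})`, `tan μ = 2 − √3` (a boundary polymer gas with a small
activity), `μ = π/12`; on a strip the θ-deformation `E₊[e^{iθB′}]` is the open `Δ = −1/2` chain with diagonal
boundary matrix of ratio `e^{2iθ}` (Sklyanin-integrable; `U_q(sl₂)`-invariant exactly at `θ = μ`), whose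
θ-derivatives at `μ` are exact percolation data (`∂_θ log Z_V|_μ = −√3|ext|`, `∂²_θ = −4E[Σ_C |C ∩ ∂V|²]`). WHY IT
MIGHT FAIL / where the depth is: (i) the tilt is a ratio of two exponentially small boundary free energies
`E₊[e^{iμB′}] = 2^{|E|}/Z₊ = e^{−O(|∂V|)}` — a sign problem: polymer/cluster expansion in `2 − √3` must control
`log E₊[e^{i⟨ε,s⟩}]` near `ε ≡ μ` past possible Lee–Yang zeros (triage r1-1/3); (ii) a GAUSSIAN boundary field
would give exponent 2 (`∂φ∂φ`), the `2/3` is a compactness effect of the integer heights at finite imaginary tilt —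
so this stub contains the half-plane one-arm exponent `1/3` of bond-ℤ² (stmt-5662) and sharp constants; it
stands or falls with them (card falsifier (3)); (iii) conformal COVARIANCE in polygons (the `|w′|^{1/3}` factors)
needs either a boundary DKLM for `P₊` with the tilt or a transport of the half-plane law — neither in print.
FIRST MILESTONES inside this stub (each a record): the strip/wall version (`w = exp`, merged card
edge-spin-dictionary's `WallTwoPointLaw`: rate `π/3` = StripClusterRates' one-cluster block, descendant spacing 1,
NO `e^{−2πt}` (two-cluster) amplitude); the q = 2 unit test (Ising, `μ′ = π/16`: `⟨σ_xσ_y⟩^{free}_{∂}` =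
`(q/4)Cov`, boundary weight 1/2, a THEOREM by discrete fermions); existence of the limit with an unidentified
kernel. Honest label: open-problem. Leans on: `CollarLegModel.*`, `sixVertexHeightModel`/`heightModelZ` (the
positive model), `PercolationRowTransfer`/`TemperleyLiebLinkPatterns` (θ = μ strip chain),
`DKLM2026_sixVertex_heightFunction_GFF` (full-plane input, unproved fact), `dirichletGreen` (covariance
bookkeeping). [arXiv:2603.06268 Thm 8/Cor 10; arXiv:2012.13750 (FKG/RP for 6V heights); PasquierSaleur1990;
Sklyanin 1988; DegierEtAl2005 (hep-th/0505062 §3.1, §6); HonglerKytola2013 / ChelkakHonglerIzyurov2015 (q = 2 test);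
SmirnovWernerMRL2001; arXiv:2205.15901 (sharp arm asymptotics on 𝕋)] -/
theorem stub_spinCumulantLaw : ∃ C : ℝ, 0 < C ∧ ∀ (D : Literature.Probability.RandomPlanarGeometry.MarkedDomain 2), (∃ S : Finset (ℂ × ℂ), (∀ p ∈ S, p.1.re = p.2.re ∨ p.1.im = p.2.im) ∧ frontier D.carrier ⊆ ⋃ p ∈ S, segment ℝ p.1 p.2) → (∀ i, ∃ r : ℝ, 0 < r ∧ ((∀ z ∈ frontier D.carrier, dist z (D.pt i) < r → z.im = (D.pt i).im) ∨ (∀ z ∈ frontier D.carrier, dist z (D.pt i) < r → z.re = (D.pt i).re))) → ∀ (w : ℂ → ℂ) (U : Set ℂ), IsOpen U → D.carrier ⊆ U → (∀ i, D.pt i ∈ U) → DifferentiableOn ℂ w U → Set.BijOn w D.carrier {z : ℂ | 0 < z.im} → (∀ i, ∃ ε : ℝ, 0 < ε ∧ StrictMonoOn (fun t : ℝ ↦ (w (D.boundary t)).re) (Set.Ioo (D.mark i - ε) (D.mark i + ε))) → ∀ (δ : ℕ → ℝ), (∀ n, 0 < δ n) → Filter.Tendsto δ Filter.atTop (nhds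 0) → ∀ (V : ℕ → Finset (ℤ × ℤ)), (∀ n, ∀ v : ℤ × ℤ, v ∈ V n ↔ ((v.1 : ℂ) * δ n + (v.2 : ℂ) * δ n * Complex.I) ∈ closure D.carrier) → ∀ (p : ℕ → Fin 2 → ℤ × ℤ), (∀ n, Function.Injective (p n)) → (∀ i, Filter.Tendsto (fun n ↦ ((p n i).1 : ℂ) * δ n + ((p n i).2 : ℂ) * δ n * Complex.I) Filter.atTop (nhds (D.pt i))) → (∀ n i, p n i ∈ V n ∧ ((Literature.Probability.LatticeModels.CollarLegModel.neighbours (p n i)).filter (fun u ↦ u ∉ V n)).card = 1) → Filter.Tendsto (fun n : ℕ ↦ (((δ n) ^ (-(2 / 3 : ℝ)) : ℝ) : ℂ) * ((∑ h ∈ (Literature.Probability.LatticeModels.CollarLegModel.ofDomain (V n)).configs, (Literature.Probability.LatticeModels.CollarLegModel.ofDomain (V n)).weight h * (((Literature.Probability.LatticeModels.CollarLegModel.ofDomain (V n)).hv h (p n 0) : ℤ) : ℂ) * (((Literature.Probability.LatticeModels.CollarLegModel.ofDomain (V n)).hv h (p n 1) : ℤ) : ℂ)) / (Literature.Probability.LatticeModels.CollarLegModel.ofDomain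 (V n)).Z - (∑ h ∈ (Literature.Probability.LatticeModels.CollarLegModel.ofDomain (V n)).configs, (Literature.Probability.LatticeModels.CollarLegModel.ofDomain (V n)).weight h * (((Literature.Probability.LatticeModels.CollarLegModel.ofDomain (V n)).hv h (p n 0) : ℤ) : ℂ)) * (∑ h ∈ (Literature.Probability.LatticeModels.CollarLegModel.ofDomain (V n)).configs, (Literature.Probability.LatticeModels.CollarLegModel.ofDomain (V n)).weight h * (((Literature.Probability.LatticeModels.CollarLegModel.ofDomain (V n)).hv h (p n 1) : ℤ) : ℂ)) / (Literature.Probability.LatticeModels.CollarLegModel.ofDomain (V n)).Z ^ 2)) Filter.atTop (nhds ((C * ‖w (D.pt 0) - w (D.pt 1)‖ ^ (-(2 / 3 : ℝ)) * (‖deriv w (D.pt 0)‖ ^ (1 / 3 : ℝ) * ‖deriv w (D.pt 1)‖ ^ (1 / 3 : ℝ)) : ℝ) : ℂ)) := by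
  sorry

/-! ## Consistency: each named statement IS its registered stub (definitionally) -/

theorem legDictionary22_holds : LegDictionary22 := stub_legDictionary22
theorem spinDictionary_holds : SpinDictionary := stub_spinDictionary
theorem spinCumulantLaw_holds : SpinCumulantLaw := stub_spinCumulantLaw

/-- **STUB 4 · `stub_otherMembers`** (XL⁺, OPEN, FOREIGN — NOT attacked by this line; recorded so that the
composition is honest about `∀ (k, L, j)`): the crux's law for EVERY leg family OTHER than `(2;2)`
(`k = 2`, `L = (2, 2)`): the mark density `(1,1,1;3)` (the route's other load-bearing member), `(1,1;2)`,
`(ℓ;ℓ)` for `ℓ ≠ 2`, and all higher rainbow families. The boundary-spin dictionary of this line does not reach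
them: the character expansion of the boundary visit transform is invertible only at TWO points (`Catalan(k) > 2^k`
from `k = 4` on; the electric reading of the mark density is REFUTED, stmt-CriticalPhenomena-6952), see the line
card. Levers on file for this stub: `sink-identity-calibration` (exponents of all families from existence +
covariance + one sink identity), `twist-anomaly-factorisation` (positive-model split `P = N·A`),
`rainbow-monomials-in-excursion-kernels` (map-free Green-monomial typing), `corner-kac-tower-strip-end` (strip
ends). RECOMMENDED to the lead / tenure planner: split the crux item along the seam "(2;2) member | all other
members" — this file types both halves and the glue (`BoundaryDefectGaussianR_of`). Signature = the crux with the
extra hypothesis `¬ (k = 2 ∧ ∀ i, L i = 2)`, verbatim. [sources: the crux item stmt-CriticalPhenomena-14132;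
CardyJPhysA1992; SmirnovWernerMRL2001; Dubedat2005] -/
theorem stub_otherMembers : ∀ (k : ℕ) (L : Fin k → ℕ) (j : Fin k), L j = ∑ i ∈ Finset.univ.erase j, L i → ¬ (k = 2 ∧ ∀ i, L i = 2) → ∃ C : ℝ, 0 < C ∧ ∀ (D : Literature.Probability.RandomPlanarGeometry.MarkedDomain k), (∃ S : Finset (ℂ × ℂ), (∀ p ∈ S, p.1.re = p.2.re ∨ p.1.im = p.2.im) ∧ frontier D.carrier ⊆ ⋃ p ∈ S, segment ℝ p.1 p.2) → (∀ i, ∃ r : ℝ, 0 < r ∧ ((∀ z ∈ frontier D.carrier, dist z (D.pt i) < r → z.im = (D.pt i).im) ∨ (∀ z ∈ frontier D.carrier, dist z (D.pt i) < r → z.re = (D.pt i).re))) → ∀ (w : ℂ → ℂ) (U : Set ℂ), IsOpen U → D.carrier ⊆ U → (∀ i, D.pt i ∈ U) → DifferentiableOn ℂ w U → Set.BijOn w D.carrier {z : ℂ | 0 < z.im} → (∀ i, ∃ ε : ℝ, 0 < ε ∧ StrictMonoOn (fun t : ℝ ↦ (w (D.boundary t)).re) (Set.Ioo (D.mark i -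 ε) (D.mark i + ε))) → ∀ (δ : ℕ → ℝ), (∀ n, 0 < δ n) → Filter.Tendsto δ Filter.atTop (nhds 0) → ∀ (V : ℕ → Finset (ℤ × ℤ)), (∀ n, ∀ v : ℤ × ℤ, v ∈ V n ↔ ((v.1 : ℂ) * δ n + (v.2 : ℂ) * δ n * Complex.I) ∈ closure D.carrier) → ∀ (p : ℕ → Fin k → ℤ × ℤ), (∀ n, Function.Injective (p n)) → (∀ i, Filter.Tendsto (fun n ↦ ((p n i).1 : ℂ) * δ n + ((p n i).2 : ℂ) * δ n * Complex.I) Filter.atTop (nhds (D.pt i))) → (∀ n, Literature.Probability.LatticeModels.CollarLegModel.LegInsertionData.IsAdmissible ⟨(Finset.univ.erase j).image (p n), fun v ↦ ∑ i ∈ (Finset.univ.erase j).filter (fun i ↦ p n i = v), L i, p n j⟩ (V n)) → Filter.Tendsto (fun n ↦ (δ n) ^ (-(∑ i : Fin k, (if i = j then (1 - (L j : ℝ)) else (L i : ℝ)) * ((if i = j then (1 - (L j : ℝ)) else (L i : ℝ)) - 1) / 6)) * ‖Literature.Probability.LatticeModels.CollarLegModel.Zins (V n) ⟨(Finset.univ.erase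 j).image (p n), fun v ↦ ∑ i ∈ (Finset.univ.erase j).filter (fun i ↦ p n i = v), L i, p n j⟩‖ / ‖(Literature.Probability.LatticeModels.CollarLegModel.ofDomain (V n)).Z‖) Filter.atTop (nhds (C * (∏ i : Fin k, ∏ i' ∈ Finset.univ.filter (fun i' : Fin k ↦ i < i'), ‖w (D.pt i) - w (D.pt i')‖ ^ ((if i = j then (1 - (L j : ℝ)) else (L i : ℝ)) * (if i' = j then (1 - (L j : ℝ)) else (L i' : ℝ)) / 3)) * ∏ i : Fin k, ‖deriv w (D.pt i)‖ ^ ((if i = j then (1 - (L j : ℝ)) else (L i : ℝ)) * ((if i = j then (1 - (L j : ℝ)) else (L i : ℝ)) - 1) / 6))) := by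
  sorry

/-- Statement of STUB 4 (the foreign residual), name-keyed below. -/
def OtherMembers : Prop :=
  ∀ (k : ℕ) (L : Fin k → ℕ) (j : Fin k), L j = ∑ i ∈ Finset.univ.erase j, L i → ¬ (k = 2 ∧ ∀ i, L i = 2) →
    MemberLaw k L j

theorem otherMembers_holds : OtherMembers := stub_otherMembers

/-! ## Name-keyed aliases of the four statements (the hypotheses of the composition) -/
namespace Registered

/-- Alias of `LegDictionary22` keyed by the registered stub name. -/
abbrev stub_legDictionary22 : Prop := LegDictionary22
/-- Alias of `SpinDictionary` keyed by the registered stub name. -/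
abbrev stub_spinDictionary : Prop := SpinDictionary
/-- Alias of `SpinCumulantLaw` keyed by the registered stub name. -/
abbrev stub_spinCumulantLaw : Prop := SpinCumulantLaw
/-- Alias of `OtherMembers` keyed by the registered stub name. -/
abbrev stub_otherMembers : Prop := OtherMembers

end Registered

/-! ## Proved glue: the `(2;2)` bookkeeping of the crux (labels `e = (2, -1)` up to order, `Σ h = 2/3`,
pair exponent `-2/3`, weights `1/3, 1/3`) and the cumulant algebra `⟨s_x s_y⟩ - ⟨s_x⟩⟨s_y⟩ = 4 P` -/

section Glue

open Literature.Probability.RandomPlanarGeometry Literature.Probability.LatticeModels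
  Literature.Probability.Percolation Literature.Probability.LatticeModels.CollarLegModel

/-- The label of insertion `i` in the `(2;2)` family with sink `j`. -/
theorem label22 (j i : Fin 2) :
    (if i = j then (1 - ((![2, 2] : Fin 2 → ℕ) j : ℝ)) else ((![2, 2] : Fin 2 → ℕ) i : ℝ)) =
      if i = j then -1 else 2 := by
  fin_cases j <;> fin_cases i <;> simp <;> norm_num

/-- `Σ_i h(e_i) = 2/3` for the `(2;2)` family. -/
theorem sum_weights22 (j : Fin 2) :
    (∑ i : Fin 2, (if i = j then (1 - ((![2, 2] : Fin 2 → ℕ) j : ℝ)) else ((![2, 2] : Fin 2 → ℕ) i : ℝ)) *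
        ((if i = j then (1 - ((![2, 2] : Fin 2 → ℕ) j : ℝ)) else ((![2, 2] : Fin 2 → ℕ) i : ℝ)) - 1) / 6) =
      2 / 3 := by
  simp only [label22]
  fin_cases j <;> simp [Fin.sum_univ_two] <;> norm_num

/-- The weight `h(e_i) = 1/3` of each insertion of the `(2;2)` family. -/
theorem weight22 (j i : Fin 2) :
    (if i = j then (1 - ((![2, 2] : Fin 2 → ℕ) j : ℝ)) else ((![2, 2] : Fin 2 → ℕ) i : ℝ)) *
        ((if i = j then (1 - ((![2, 2] : Fin 2 → ℕ) j : ℝ)) else ((![2, 2] : Fin 2 → ℕ) i : ℝ)) - 1) / 6 =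
      1 / 3 := by
  rw [label22]
  split_ifs <;> norm_num

/-- The pair exponent `e_0 e_1 / 3 = -2/3` of the `(2;2)` family. -/
theorem pair22 (j : Fin 2) :
    (if (0 : Fin 2) = j then (1 - ((![2, 2] : Fin 2 → ℕ) j : ℝ)) else ((![2, 2] : Fin 2 → ℕ) 0 : ℝ)) *
        (if (1 : Fin 2) = j then (1 - ((![2, 2] : Fin 2 → ℕ) j : ℝ)) else ((![2, 2] : Fin 2 → ℕ) 1 : ℝ)) / 3 =
      -(2 / 3 : ℝ) := by
  rw [label22 j 0, label22 j 1]
  fin_cases j <;> simp <;> norm_num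

theorem filter_gt_zero : (Finset.univ.filter fun i' : Fin 2 => (0 : Fin 2) < i') = {1} := by decide

theorem filter_gt_one : (Finset.univ.filter fun i' : Fin 2 => (1 : Fin 2) < i') = ∅ := by decide

/-- The right-hand side of the `(2;2)` member in the product form of the crux. -/
theorem rhs22 (j : Fin 2) (w : ℂ → ℂ) (D : MarkedDomain 2) (C : ℝ) :
    C * (∏ i : Fin 2, ∏ i' ∈ Finset.univ.filter (fun i' : Fin 2 ↦ i < i'),
        ‖w (D.pt i) - w (D.pt i')‖ ^
          ((if i = j then (1 - ((![2, 2] : Fin 2 → ℕ) j : ℝ)) else ((![2, 2] : Fin 2 → ℕ) i : ℝ)) *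
            (if i' = j then (1 - ((![2, 2] : Fin 2 → ℕ) j : ℝ)) else ((![2, 2] : Fin 2 → ℕ) i' : ℝ)) / 3)) *
      ∏ i : Fin 2, ‖deriv w (D.pt i)‖ ^
        ((if i = j then (1 - ((![2, 2] : Fin 2 → ℕ) j : ℝ)) else ((![2, 2] : Fin 2 → ℕ) i : ℝ)) *
          ((if i = j then (1 - ((![2, 2] : Fin 2 → ℕ) j : ℝ)) else ((![2, 2] : Fin 2 → ℕ) i : ℝ)) - 1) / 6) =
    C * ‖w (D.pt 0) - w (D.pt 1)‖ ^ (-(2 / 3 : ℝ)) *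
      (‖deriv w (D.pt 0)‖ ^ (1 / 3 : ℝ) * ‖deriv w (D.pt 1)‖ ^ (1 / 3 : ℝ)) := by
  simp only [weight22]
  rw [Fin.prod_univ_two, Fin.prod_univ_two, filter_gt_zero, filter_gt_one, Finset.prod_singleton,
    Finset.prod_empty, mul_one, pair22]

/-- Cumulant algebra: `Z = 2^N`, `S₁ = i√3·Z`, `S₂ = (4P - 3)·Z` give `S₂/Z - S₁S₁'/Z² = 4P`. -/
theorem cumulant_eq {Z S₁ S₁' S₂ : ℂ} {N : ℕ} {P : ℝ} (hZ : Z = (2 : ℂ) ^ N)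
    (h₁ : S₁ = Complex.I * ((Real.sqrt 3 : ℝ) : ℂ) * Z) (h₁' : S₁' = Complex.I * ((Real.sqrt 3 : ℝ) : ℂ) * Z)
    (h₂ : S₂ = (4 * (P : ℂ) - 3) * Z) :
    S₂ / Z - S₁ * S₁' / Z ^ 2 = ((4 * P : ℝ) : ℂ) := by
  have hZ0 : Z ≠ 0 := by rw [hZ]; exact pow_ne_zero _ two_ne_zero
  have h3 : ((Real.sqrt 3 : ℝ) : ℂ) * ((Real.sqrt 3 : ℝ) : ℂ) = 3 := by
    rw [← Complex.ofReal_mul, Real.mul_self_sqrt (by norm_num : (0 : ℝ) ≤ 3)]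
    norm_num
  have hprod : S₁ * S₁' = -3 * Z ^ 2 := by
    rw [h₁, h₁']
    linear_combination (((Real.sqrt 3 : ℝ) : ℂ) * ((Real.sqrt 3 : ℝ) : ℂ) * Z ^ 2) * Complex.I_sq
      + (-(Z ^ 2)) * h3
  rw [hprod, h₂]
  field_simp
  push_cast
  ring

/-- **The REACH of the line**: STUBS 1–3 give the `(2;2)` member of the crux, for either sink index. -/
theorem member22 (hLeg : Registered.stub_legDictionary22) (hSpin : Registered.stub_spinDictionary)
    (hCum : Registered.stub_spinCumulantLaw) (j : Fin 2) : MemberLaw 2 ![2, 2] j := by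
  obtain ⟨C, hC, H⟩ := hCum
  refine ⟨C / 4, by positivity, ?_⟩
  intro D hrect hnc w U hU hsub hpt hw hbij hor δ hδ hδ0 V hV p hpinj hplim hadm
  -- boundary-vertex facts for the insertion points, from admissibility
  have hbv : ∀ n i, p n i ∈ V n ∧ ((neighbours (p n i)).filter (fun u ↦ u ∉ V n)).card = 1 := by
    intro n i
    obtain ⟨-, -, -, h4, -, -⟩ := hadm n
    have hmem : p n i ∈ insert (p n j) ((Finset.univ.erase j).image (p n)) := by
      by_cases hij : i = j
      · subst hij; exact Finset.mem_insert_self _ _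
      · exact Finset.mem_insert_of_mem (Finset.mem_image_of_mem _ (Finset.mem_erase.2 ⟨hij, Finset.mem_univ _⟩))
    obtain ⟨hm, hcard, -⟩ := h4 (p n i) hmem
    exact ⟨hm, hcard⟩
  -- the cumulant law for this geometry
  have HC := H D hrect hnc w U hU hsub hpt hw hbij hor δ hδ hδ0 V hV p hpinj hplim hbv
  -- the dictionaries, eventually
  have HL := hLeg D.toJordanDomain hrect δ hδ hδ0 V hV
  have HS := hSpin D.toJordanDomain hrect δ hδ hδ0 V hV
  -- abbreviations
  set P : ℕ → ℝ := fun n ↦ (bondPercolation (zdGraph 2) half).real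
      (openConnIn {s : Site 2 | (s 0, s 1) ∈ V n} ![(p n 0).1, (p n 0).2] ![(p n 1).1, (p n 1).2]) with hPdef
  -- Step 1: the cumulant equals `4 P n`, eventually
  have hcum : ∀ᶠ n in atTop,
      ((∑ h ∈ (ofDomain (V n)).configs, (ofDomain (V n)).weight h *
          (((ofDomain (V n)).hv h (p n 0) : ℤ) : ℂ) * (((ofDomain (V n)).hv h (p n 1) : ℤ) : ℂ)) /
          (ofDomain (V n)).Z -
        (∑ h ∈ (ofDomain (V n)).configs, (ofDomain (V n)).weight h * (((ofDomain (V n)).hv h (p n 0) : ℤ) : ℂ)) *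
          (∑ h ∈ (ofDomain (V n)).configs, (ofDomain (V n)).weight h * (((ofDomain (V n)).hv h (p n 1) : ℤ) : ℂ)) /
          (ofDomain (V n)).Z ^ 2) = ((4 * P n : ℝ) : ℂ) := by
    filter_upwards [HS] with n hn
    obtain ⟨hZ, hrest⟩ := hn
    obtain ⟨h1x, hxy⟩ := hrest (p n 0) (hbv n 0).1 (hbv n 0).2
    obtain ⟨h1y, -⟩ := hrest (p n 1) (hbv n 1).1 (hbv n 1).2
    have h2 := hxy (p n 1) (hbv n 1).1 (hbv n 1).2
    exact cumulant_eq hZ h1x h1y h2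
  -- Step 2: the real sequence `δ_n^{-2/3} · 4 P n` converges
  have HC' : Tendsto (fun n : ℕ ↦ (((δ n) ^ (-(2 / 3 : ℝ)) * (4 * P n) : ℝ) : ℂ)) atTop
      (𝓝 ((C * ‖w (D.pt 0) - w (D.pt 1)‖ ^ (-(2 / 3 : ℝ)) *
        (‖deriv w (D.pt 0)‖ ^ (1 / 3 : ℝ) * ‖deriv w (D.pt 1)‖ ^ (1 / 3 : ℝ)) : ℝ) : ℂ)) := by
    refine HC.congr' ?_
    filter_upwards [hcum] with n hn
    rw [hn]
    push_cast
    ring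
  have HR : Tendsto (fun n : ℕ ↦ (δ n) ^ (-(2 / 3 : ℝ)) * (4 * P n)) atTop
      (𝓝 (C * ‖w (D.pt 0) - w (D.pt 1)‖ ^ (-(2 / 3 : ℝ)) *
        (‖deriv w (D.pt 0)‖ ^ (1 / 3 : ℝ) * ‖deriv w (D.pt 1)‖ ^ (1 / 3 : ℝ)))) := by
    have := (Complex.continuous_re.tendsto _).comp HC'
    simpa only [Function.comp_def, Complex.ofReal_re] using this
  have HR4 := HR.const_mul (1 / 4 : ℝ)
  -- Step 3: rewrite the target and transfer along the leg dictionary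
  rw [rhs22]
  have key : Tendsto (fun n : ℕ ↦ (δ n) ^ (-(2 / 3 : ℝ)) * P n) atTop
      (𝓝 (C / 4 * ‖w (D.pt 0) - w (D.pt 1)‖ ^ (-(2 / 3 : ℝ)) *
        (‖deriv w (D.pt 0)‖ ^ (1 / 3 : ℝ) * ‖deriv w (D.pt 1)‖ ^ (1 / 3 : ℝ)))) := by
    convert HR4 using 1
    · funext n; ring
    · congr 1; ring
  refine key.congr' ?_
  filter_upwards [HL, HS] with n hLn hSn
  have hZn : ‖(ofDomain (V n)).Z‖ ≠ 0 := by
    rw [hSn.1, norm_pow, Complex.norm_ofNat]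
    exact pow_ne_zero _ two_ne_zero
  rw [sum_weights22, hLn (p n) j (hadm n), mul_div_assoc, mul_div_cancel_right₀ _ hZn]

end Glue

/-! ## The composition: the four stubs imply the crux, by name -/

/-- `BoundaryDefectGaussianR` from the four stubs (pure logic; no `sorry`): the `(2;2)` family (either sink
index) is the REACH of the line (`member22` = STUBS 1–3), every other family is the foreign STUB 4. -/
theorem BoundaryDefectGaussianR_of (hLeg : Registered.stub_legDictionary22) (hSpin : Registered.stub_spinDictionary)
    (hCum : Registered.stub_spinCumulantLaw) (hRest : Registered.stub_otherMembers) :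
    Summit.CriticalPhenomena.CardyFormulaZ2.Theses.CardyBoundaryCoulombGas.BoundaryDefectGaussianR := by
  rw [boundaryDefectGaussianR_iff]
  intro k L j hL
  by_cases h : k = 2 ∧ ∀ i, L i = 2
  · obtain ⟨rfl, hL2⟩ := h
    have hLL : L = ![2, 2] := funext fun i ↦ by fin_cases i <;> simp [hL2]
    subst hLL
    exact member22 hLeg hSpin hCum j
  · exact hRest k L j hL h

end Summit.CriticalPhenomena.CardyFormulaZ2.Cruxes.BoundaryDefectGaussianR.ConnectivityIsBoundarySpinCovariance
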